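import Mathlib.GroupTheory.Perm.Cycle.Concrete
import Mathlib.Data.Fin.VecNotation
import Mathlib.GroupTheory.Perm.Cycle.Type

/-!
# Route «KPlusLogSqLaw», crux `TropicalB` (stmt-ValiantsHypothesis-19771) — SINGLE-CYCLE PAIRWISE QUOTIENTS AT `m = 8`:
# an explicit family of 28 permutations of `Fin 8` with every pairwise quotient a single cycle (kernel certificate; `PSC(8) ≥ 28`)

HONEST FRAMING.  Helper file (cell `pub-symmetroid`, seat val-sym-trop-p1 g30, 2026-08-29; `--supports stmt-ValiantsHypothesis-19771 --as helper`), a FINITE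
census datum of the lineage's pairwise-quotient calculus (…TropicalBSingleCycleQuotients, val-sym-trop-p1 g29: `exists_singleCycleQuotients'` gives families with
single-cycle pairwise quotients of size `⌊(m−1)²/4⌋ + m`, i.e. `20` at `m = 8`, shown inclusion-maximal there by the seat's search).  Pure permutation combinatorics:
nothing here bears on `TropicalB` in its window, `WeakLifting`, the doors, `MatrixDescartes` (stmt-ValiantsHypothesis-18050) or VP ≠ VNP.  WHY IT IS RECORDED: a
«PSC family» (all pairwise quotients `σ⁻¹τ` single cycles) listed in slope order is automatically consistent with the pairwise exchange law of dominant chains for ANY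
static class map (g29 memo PAIRWISE-ODOMETERS §1, kernel `partialGain_pos_of_isCycle`), so `max |PSC(m)|` calibrates how much the pairwise law alone can constrain a
chain; the located values are `PSC(4..7) = 6, 13, 18, 23` (exact; `PSC(7) = 23` by this seat's symmetry-split branch and bound, memo HUB-LAWS-g30 §7) and the
Delsarte/character LP ceiling is exponential (§6), so the growth of `PSC` is open between `max(5m − 12, ⌊(m−1)²/4⌋ + m)`-type floors and `2^{Θ(m)}`.

* `isCycle_of_witness` — a bounded, `decide`-friendly sufficient condition for `IsCycle` on `Perm (Fin 8)` (a moved point from which every moved point is reached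
  by a power `< 8`).
* **`psc_eight_28`** — `∃ f : Fin 28 → Perm (Fin 8), Function.Injective f ∧ ∀ i j, i ≠ j → IsCycle ((f i)⁻¹ * f j)`: the identity, the transposition `(0 1)`, three
  3-cycles, five 4-cycles, one 5-cycle, three 6-cycles, one 7-cycle and eleven 8-cycles (found by `c/psc7.c` of the seat's deposit HOME/val-sym-trop-p1/g30/, re-verified
  independently in integers; all `756` ordered pairs certified by ONE `decide +kernel` on the bounded witness condition).  So **`PSC(8) ≥ 28 > 20`**: at `m = 8`
  the quadratic family of g29 is maximal but not maximum.
[this lineage's located object; no citation exists]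
-/

set_option linter.dupNamespace false
set_option autoImplicit false

namespace Summit.ValiantsHypothesis.ValiantsHypothesis.Theorems.KPlusLogSqLaw.SingleCycleQuotients

open Equiv Equiv.Perm

/-- a `decide`-friendly witness for `IsCycle` on `Fin 8`: some moved point `x` reaches every moved point by a power `σ^i`, `i < 8`. [elementary] -/
theorem isCycle_of_witness {σ : Perm (Fin 8)}
    (h : ∃ x : Fin 8, σ x ≠ x ∧ ∀ y : Fin 8, σ y ≠ y → ∃ i : Fin 8, (σ ^ (i : ℕ)) x = y) : σ.IsCycle := by
  obtain ⟨x, hx, hall⟩ := h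
  refine ⟨x, hx, fun y hy => ?_⟩
  obtain ⟨i, hi⟩ := hall y hy
  exact ⟨(i : ℕ), by simpa using hi⟩

/-- **`PSC(8) ≥ 28`**: 28 permutations of `Fin 8`, pairwise distinct, with every pairwise quotient `(f i)⁻¹ * f j` (`i ≠ j`) a single cycle. [this lineage's located
object, kernel-certified here] -/
theorem psc_eight_28 : ∃ f : Fin 28 → Perm (Fin 8), Function.Injective f ∧ ∀ i j, i ≠ j → ((f i)⁻¹ * f j).IsCycle := by
  let f : Fin 28 → Perm (Fin 8) := ![
    (1 : Equiv.Perm (Fin 8)),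
    List.formPerm ([0, 1] : List (Fin 8)),
    List.formPerm ([0, 1, 2, 5, 4, 3, 6, 7] : List (Fin 8)),
    List.formPerm ([0, 1, 5, 4, 2, 3, 6, 7] : List (Fin 8)),
    List.formPerm ([0, 1, 2, 3, 5, 4, 6, 7] : List (Fin 8)),
    List.formPerm ([0, 1, 6, 7] : List (Fin 8)),
    List.formPerm ([0, 1, 5, 2, 3, 4, 6, 7] : List (Fin 8)),
    List.formPerm ([0, 1, 3, 5, 2, 4, 6, 7] : List (Fin 8)),
    List.formPerm ([0, 1, 3, 4, 5, 2, 6, 7] : List (Fin 8)),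
    List.formPerm ([0, 1, 5, 3, 4, 2, 6, 7] : List (Fin 8)),
    List.formPerm ([0, 1, 2, 4, 3, 5, 6, 7] : List (Fin 8)),
    List.formPerm ([0, 1, 4, 3, 2, 5, 6, 7] : List (Fin 8)),
    List.formPerm ([0, 1, 3, 2, 4, 5, 6, 7] : List (Fin 8)),
    List.formPerm ([0, 1, 4, 5, 3, 2, 6, 7] : List (Fin 8)),
    List.formPerm ([0, 1, 4, 2, 5, 3, 6, 7] : List (Fin 8)),
    List.formPerm ([0, 1, 6, 4, 7] : List (Fin 8)),
    List.formPerm ([0, 1, 6, 3, 7] : List (Fin 8)),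
    List.formPerm ([0, 1, 7] : List (Fin 8)),
    List.formPerm ([0, 1, 6, 2, 7] : List (Fin 8)),
    List.formPerm ([0, 1, 6, 5, 7] : List (Fin 8)),
    List.formPerm ([0, 1, 6, 5] : List (Fin 8)),
    List.formPerm ([1, 6, 5] : List (Fin 8)),
    List.formPerm ([1, 6, 4] : List (Fin 8)),
    List.formPerm ([0, 1, 6, 4] : List (Fin 8)),
    List.formPerm ([1, 6, 2] : List (Fin 8)),
    List.formPerm ([0, 1, 6, 2] : List (Fin 8)),
    List.formPerm ([1, 6, 3] : List (Fin 8)),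
    List.formPerm ([0, 1, 6, 3] : List (Fin 8)) ]
  have hW : ∀ i j : Fin 28, i ≠ j → ∃ x : Fin 8, ((f i)⁻¹ * f j) x ≠ x ∧
      ∀ y : Fin 8, ((f i)⁻¹ * f j) y ≠ y → ∃ k : Fin 8, (((f i)⁻¹ * f j) ^ (k : ℕ)) x = y := by
    decide +kernel
  have key : ∀ i j, i ≠ j → ((f i)⁻¹ * f j).IsCycle := fun i j hij => isCycle_of_witness (hW i j hij)
  refine ⟨f, fun i j hij => ?_, key⟩
  by_contra hne
  exact (key i j hne).ne_one (by rw [hij, inv_mul_cancel])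

end Summit.ValiantsHypothesis.ValiantsHypothesis.Theorems.KPlusLogSqLaw.SingleCycleQuotients
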